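import Mathlib
import Summits.Ventures.PercRepro2.Defs
import Summits.Ventures.PercRepro2.CoinTraceBlock
import Summits.Ventures.PercRepro2.CoinTraceShift
import Summits.Ventures.PercRepro2.CoinTraceBlocks
import Summits.Ventures.PercRepro2.CoinTraceBlocks2
import Summits.Ventures.PercRepro2.CoinLayerCake
import Summits.Ventures.PercRepro2.CoinTwoChainsHard
import Summits.Ventures.PercRepro2.CoinTwoChainsHardCD
import Summits.Ventures.PercRepro2.CoinTwoChainsUpsets

/-!
# The abstract pendant lemma for TWO CHAINS OF LENGTH 2 on ALL regimes (blind cell PercRepro2,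
night-2 g4; proofs/NIGHT2-DARC.md §24.3)

`P = {w, v₁, v₂, v₃, v₄}`, routes `w → v₁ → v₂ → t`, `w → v₃ → v₄ → t`; the traces with mass
containing `w` are `A = wv₁v₂`, `B = wv₃v₄`, `C = wv₁v₂v₄`, `D = wv₂v₃v₄`, `E = P`
(`twoChains_wtrace_classify`, CoinTwoChainsUpsets.lean).  By the finite layer cake (`upset_layer_nonneg`) it suffices that
every up-set of the pivotal family has a nonnegative block; the ten up-sets of the poset
`A ⊂ C ⊂ E ⊃ D ⊃ B` are `∅` (block (a)), `{E}` (block (c)), the four vertex families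
`𝒱_{v₁} = {A,C,E}`, `𝒱_{v₂} = {A,C,D,E}`, `𝒱_{v₃} = {B,D,E}`, `𝒱_{v₄} = {B,C,D,E}` (§15.8), the
whole family (block (b)), and the three union-type up-sets `{C,E}`, `{D,E}`, `{C,D,E}`
(CoinTwoChainsHard / CoinTwoChainsHardCD).  Hence `S′ ≥ 0` for EVERY monotone pivotal weight
(`twoChains_functional_nonneg'`): the two subadditivity hypotheses of
`twoChains_functional_nonneg` (§19.7) are gone.
-/

namespace Summit.Ventures.PercRepro2.Coin

section TwoChainsAll

open Classical

variable {V : Type*} [DecidableEq V] {R : Type*} [Field R] [LinearOrder R] [IsStrictOrderedRing R]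

/-- **The abstract pendant lemma for two chains of length 2 on ALL regimes**: only the
monotonicity of the pivotal weight is needed. -/
theorem twoChains_functional_nonneg' {w v₁ v₂ v₃ v₄ : V} (hwv₁ : w ≠ v₁) (hwv₂ : w ≠ v₂)
    (hwv₃ : w ≠ v₃) (hwv₄ : w ≠ v₄) (hv₁₂ : v₁ ≠ v₂) (hv₁₃ : v₁ ≠ v₃) (hv₁₄ : v₁ ≠ v₄)
    (hv₂₃ : v₂ ≠ v₃) (hv₂₄ : v₂ ≠ v₄) (hv₃₄ : v₃ ≠ v₄) (μ x y xh yh ρ : Finset V → R)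
    (hμ : ∀ Z ∈ ({w, v₁, v₂, v₃, v₄} : Finset V).powerset, 0 ≤ μ Z)
    (hμ0a : ∀ Z ∈ ({w, v₁, v₂, v₃, v₄} : Finset V).powerset, v₁ ∈ Z → v₂ ∉ Z → μ Z = 0)
    (hμ0b : ∀ Z ∈ ({w, v₁, v₂, v₃, v₄} : Finset V).powerset, v₃ ∈ Z → v₄ ∉ Z → μ Z = 0)
    (hμ0c : ∀ Z ∈ ({w, v₁, v₂, v₃, v₄} : Finset V).powerset, w ∈ Z → ¬ (v₁ ∈ Z ∧ v₂ ∈ Z) →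
      ¬ (v₃ ∈ Z ∧ v₄ ∈ Z) → μ Z = 0)
    (hx1 : ∀ Z : Finset V, Z ⊆ ({w, v₁, v₂, v₃, v₄} : Finset V) → x Z ≤ 1)
    (hy1 : ∀ Z : Finset V, Z ⊆ ({w, v₁, v₂, v₃, v₄} : Finset V) → y Z ≤ 1)
    (hxh1 : ∀ Z : Finset V, Z ⊆ ({w, v₁, v₂, v₃, v₄} : Finset V) → xh Z ≤ 1)
    (hyh1 : ∀ Z : Finset V, Z ⊆ ({w, v₁, v₂, v₃, v₄} : Finset V) → yh Z ≤ 1)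
    (hxanti : ∀ Z Z' : Finset V, Z ⊆ Z' → Z' ⊆ ({w, v₁, v₂, v₃, v₄} : Finset V) → x Z' ≤ x Z)
    (hyanti : ∀ Z Z' : Finset V, Z ⊆ Z' → Z' ⊆ ({w, v₁, v₂, v₃, v₄} : Finset V) → y Z' ≤ y Z)
    (hxhanti : ∀ Z Z' : Finset V, Z ⊆ Z' → Z' ⊆ ({w, v₁, v₂, v₃, v₄} : Finset V) → xh Z' ≤ xh Z)
    (hyhanti : ∀ Z Z' : Finset V, Z ⊆ Z' → Z' ⊆ ({w, v₁, v₂, v₃, v₄} : Finset V) → yh Z' ≤ yh Z)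
    (hxh_le : ∀ Z : Finset V, Z ⊆ ({w, v₁, v₂, v₃, v₄} : Finset V) → xh Z ≤ x Z)
    (hyh_le : ∀ Z : Finset V, Z ⊆ ({w, v₁, v₂, v₃, v₄} : Finset V) → yh Z ≤ y Z)
    (hxh_eq : ∀ Z : Finset V, Z ⊆ ({w, v₁, v₂, v₃, v₄} : Finset V) → w ∉ Z → xh Z = x Z)
    (hyh_eq : ∀ Z : Finset V, Z ⊆ ({w, v₁, v₂, v₃, v₄} : Finset V) → w ∉ Z → yh Z = y Z)
    (hρ1 : ∀ Z ∈ ({w, v₁, v₂, v₃, v₄} : Finset V).powerset, w ∉ Z → ρ Z = 1)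
    (hρ0 : ∀ Z ∈ ({w, v₁, v₂, v₃, v₄} : Finset V).powerset, 0 ≤ ρ Z)
    (hρle : ∀ Z ∈ ({w, v₁, v₂, v₃, v₄} : Finset V).powerset, ρ Z ≤ 1)
    (hρmono : ∀ Z ∈ ({w, v₁, v₂, v₃, v₄} : Finset V).powerset,
      ∀ Z' ∈ ({w, v₁, v₂, v₃, v₄} : Finset V).powerset, w ∈ Z → Z ⊆ Z' → ρ Z ≤ ρ Z')
    (hPA : TracePA ({w, v₁, v₂, v₃, v₄} : Finset V) μ)
    (hCU₁ : TraceCUPA ({w, v₁, v₂, v₃, v₄} : Finset V) μ v₁)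
    (hCU₂ : TraceCUPA ({w, v₁, v₂, v₃, v₄} : Finset V) μ v₂)
    (hCU₃ : TraceCUPA ({w, v₁, v₂, v₃, v₄} : Finset V) μ v₃)
    (hCU₄ : TraceCUPA ({w, v₁, v₂, v₃, v₄} : Finset V) μ v₄)
    (hCU₁₄ : ∀ f₁ f₂ : Finset V → R,
      (∀ Z Z' : Finset V, Z ⊆ Z' → Z' ⊆ ({w, v₁, v₂, v₃, v₄} : Finset V) → f₁ Z ≤ f₁ Z') →
      (∀ Z Z' : Finset V, Z ⊆ Z' → Z' ⊆ ({w, v₁, v₂, v₃, v₄} : Finset V) → f₂ Z ≤ f₂ Z') →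
      (∀ Z : Finset V, Z ⊆ ({w, v₁, v₂, v₃, v₄} : Finset V) → 0 ≤ f₁ Z) →
      (∀ Z : Finset V, Z ⊆ ({w, v₁, v₂, v₃, v₄} : Finset V) → 0 ≤ f₂ Z) →
      (∑ Z ∈ ({w, v₁, v₂, v₃, v₄} : Finset V).powerset.filter (fun Z => v₁ ∈ Z ∧ v₄ ∈ Z), f₁ Z * μ Z) *
          (∑ Z ∈ ({w, v₁, v₂, v₃, v₄} : Finset V).powerset.filter (fun Z => v₁ ∈ Z ∧ v₄ ∈ Z), f₂ Z * μ Z) ≤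
        (∑ Z ∈ ({w, v₁, v₂, v₃, v₄} : Finset V).powerset.filter (fun Z => v₁ ∈ Z ∧ v₄ ∈ Z), f₁ Z * f₂ Z * μ Z) *
          ∑ Z ∈ ({w, v₁, v₂, v₃, v₄} : Finset V).powerset.filter (fun Z => v₁ ∈ Z ∧ v₄ ∈ Z), μ Z)
    (hCU₃₂ : ∀ f₁ f₂ : Finset V → R,
      (∀ Z Z' : Finset V, Z ⊆ Z' → Z' ⊆ ({w, v₁, v₂, v₃, v₄} : Finset V) → f₁ Z ≤ f₁ Z') →
      (∀ Z Z' : Finset V, Z ⊆ Z' → Z' ⊆ ({w, v₁, v₂, v₃, v₄} : Finset V) → f₂ Z ≤ f₂ Z') →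
      (∀ Z : Finset V, Z ⊆ ({w, v₁, v₂, v₃, v₄} : Finset V) → 0 ≤ f₁ Z) →
      (∀ Z : Finset V, Z ⊆ ({w, v₁, v₂, v₃, v₄} : Finset V) → 0 ≤ f₂ Z) →
      (∑ Z ∈ ({w, v₁, v₂, v₃, v₄} : Finset V).powerset.filter (fun Z => v₃ ∈ Z ∧ v₂ ∈ Z), f₁ Z * μ Z) *
          (∑ Z ∈ ({w, v₁, v₂, v₃, v₄} : Finset V).powerset.filter (fun Z => v₃ ∈ Z ∧ v₂ ∈ Z), f₂ Z * μ Z) ≤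
        (∑ Z ∈ ({w, v₁, v₂, v₃, v₄} : Finset V).powerset.filter (fun Z => v₃ ∈ Z ∧ v₂ ∈ Z), f₁ Z * f₂ Z * μ Z) *
          ∑ Z ∈ ({w, v₁, v₂, v₃, v₄} : Finset V).powerset.filter (fun Z => v₃ ∈ Z ∧ v₂ ∈ Z), μ Z)
    (hCU₂₄ : ∀ f₁ f₂ : Finset V → R,
      (∀ Z Z' : Finset V, Z ⊆ Z' → Z' ⊆ ({w, v₁, v₂, v₃, v₄} : Finset V) → f₁ Z ≤ f₁ Z') →
      (∀ Z Z' : Finset V, Z ⊆ Z' → Z' ⊆ ({w, v₁, v₂, v₃, v₄} : Finset V) → f₂ Z ≤ f₂ Z') →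
      (∀ Z : Finset V, Z ⊆ ({w, v₁, v₂, v₃, v₄} : Finset V) → 0 ≤ f₁ Z) →
      (∀ Z : Finset V, Z ⊆ ({w, v₁, v₂, v₃, v₄} : Finset V) → 0 ≤ f₂ Z) →
      (∑ Z ∈ ({w, v₁, v₂, v₃, v₄} : Finset V).powerset.filter (fun Z => v₂ ∈ Z ∧ v₄ ∈ Z), f₁ Z * μ Z) *
          (∑ Z ∈ ({w, v₁, v₂, v₃, v₄} : Finset V).powerset.filter (fun Z => v₂ ∈ Z ∧ v₄ ∈ Z), f₂ Z * μ Z) ≤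
        (∑ Z ∈ ({w, v₁, v₂, v₃, v₄} : Finset V).powerset.filter (fun Z => v₂ ∈ Z ∧ v₄ ∈ Z), f₁ Z * f₂ Z * μ Z) *
          ∑ Z ∈ ({w, v₁, v₂, v₃, v₄} : Finset V).powerset.filter (fun Z => v₂ ∈ Z ∧ v₄ ∈ Z), μ Z) :
    0 ≤ ∑ Z ∈ ({w, v₁, v₂, v₃, v₄} : Finset V).powerset, μ Z * ρ Z *
      (xh Z * (∑ Z' ∈ ({w, v₁, v₂, v₃, v₄} : Finset V).powerset, μ Z') - ∑ Z' ∈ ({w, v₁, v₂, v₃, v₄} : Finset V).powerset, x Z' * μ Z') *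
      (yh Z * (∑ Z' ∈ ({w, v₁, v₂, v₃, v₄} : Finset V).powerset, μ Z') - ∑ Z' ∈ ({w, v₁, v₂, v₃, v₄} : Finset V).powerset, y Z' * μ Z') := by
  set P : Finset V := {w, v₁, v₂, v₃, v₄} with hPdef
  have hwP : w ∈ P := by simp [hPdef]
  have hv₁P : v₁ ∈ P := by simp [hPdef]
  have hv₂P : v₂ ∈ P := by simp [hPdef]
  have hv₃P : v₃ ∈ P := by simp [hPdef]
  have hv₄P : v₄ ∈ P := by simp [hPdef]
  have hPel : ∀ z ∈ P, z = w ∨ z = v₁ ∨ z = v₂ ∨ z = v₃ ∨ z = v₄ := by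
    intro z hz
    simpa only [hPdef, Finset.mem_insert, Finset.mem_singleton] using hz
  obtain ⟨Λ, hΛ⟩ : ∃ L : R, L = ∑ Z ∈ P.powerset, μ Z := ⟨_, rfl⟩
  obtain ⟨MX, hMX⟩ : ∃ M : R, M = ∑ Z ∈ P.powerset, x Z * μ Z := ⟨_, rfl⟩
  obtain ⟨MY, hMY⟩ : ∃ M : R, M = ∑ Z ∈ P.powerset, y Z * μ Z := ⟨_, rfl⟩
  rw [← hΛ, ← hMX, ← hMY]
  set T : Finset V → R := fun Z => μ Z * (xh Z * Λ - MX) * (yh Z * Λ - MY) with hTdef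
  -- the blocks
  have hA' := avoid_block_nonneg P hwP μ x y xh yh hμ hx1 hy1 hxh1 hyh1 hxanti hyanti hxhanti
    hyhanti hxh_eq hyh_eq hPA
  have hTop := top_block_nonneg P hwP μ x y xh yh hμ hx1 hy1 hxh1 hyh1 hxanti hyanti hxhanti
    hyhanti hxh_le hyh_le hxh_eq hyh_eq hPA
  have hC₁ := cylinder_block_nonneg P hwP hv₁P μ x y xh yh hμ hx1 hy1 hxh1 hyh1 hxanti hyanti
    hxhanti hyhanti hxh_le hyh_le hxh_eq hyh_eq hPA hCU₁
  have hC₂ := cylinder_block_nonneg P hwP hv₂P μ x y xh yh hμ hx1 hy1 hxh1 hyh1 hxanti hyanti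
    hxhanti hyhanti hxh_le hyh_le hxh_eq hyh_eq hPA hCU₂
  have hC₃ := cylinder_block_nonneg P hwP hv₃P μ x y xh yh hμ hx1 hy1 hxh1 hyh1 hxanti hyanti
    hxhanti hyhanti hxh_le hyh_le hxh_eq hyh_eq hPA hCU₃
  have hC₄ := cylinder_block_nonneg P hwP hv₄P μ x y xh yh hμ hx1 hy1 hxh1 hyh1 hxanti hyanti
    hxhanti hyhanti hxh_le hyh_le hxh_eq hyh_eq hPA hCU₄
  have hAll := all_block_nonneg P μ x y xh yh hμ hxh1 hyh1 hxhanti hyhanti hxh_le hyh_le hPA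
  have hHC := twoChains_hard_block_nonneg P hwP hv₁P hv₂P hv₃P hv₄P hPel hwv₁ hwv₂ hwv₃ hwv₄ hv₁₂
    hv₁₃ hv₁₄ hv₂₃ hv₂₄ hv₃₄ μ x y xh yh hμ hμ0a hμ0b hμ0c hx1 hy1 hxh1 hyh1 hxanti hyanti hxhanti
    hyhanti hxh_le hyh_le hxh_eq hyh_eq hPA hCU₁ hCU₁₄
  have hHD := twoChains_hard_block_nonneg P hwP hv₃P hv₄P hv₁P hv₂P
    (fun z hz => by rcases hPel z hz with h | h | h | h | h <;> tauto)
    hwv₃ hwv₄ hwv₁ hwv₂ hv₃₄ hv₁₃.symm hv₂₃.symm hv₁₄.symm hv₂₄.symm hv₁₂ μ x y xh yh hμ hμ0b hμ0a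
    (fun Z hZ hw h1 h2 => hμ0c Z hZ hw h2 h1) hx1 hy1 hxh1 hyh1 hxanti hyanti hxhanti hyhanti
    hxh_le hyh_le hxh_eq hyh_eq hPA hCU₃ hCU₃₂
  have hHCD := twoChains_hardCD_block_nonneg P hwP hv₁P hv₂P hv₃P hv₄P hPel hwv₁ hwv₂ hwv₃ hwv₄
    hv₁₂ hv₁₃ hv₁₄ hv₂₃ hv₂₄ hv₃₄ μ x y xh yh hμ hμ0a hμ0b hμ0c hx1 hy1 hxh1 hyh1 hxanti hyanti
    hxhanti hyhanti hxh_le hyh_le hxh_eq hyh_eq hPA hCU₁ hCU₄ hCU₁₄ hCU₂₄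
  rw [← hΛ, ← hMX, ← hMY] at hA' hTop hC₁ hC₂ hC₃ hC₄ hAll hHC hHD hHCD
  -- the split of `S′` into the non-pivotal part `b` and the pivotal sum
  set I : Finset (Finset V) := P.powerset.filter (fun Z => w ∈ Z) with hIdef
  set b : R := ∑ Z ∈ P.powerset.filter (fun Z => Disjoint Z {w}), T Z with hbdef
  have hsplit := Finset.sum_filter_add_sum_filter_not P.powerset (fun Z => Disjoint Z {w})
    (fun Z => μ Z * ρ Z * (xh Z * Λ - MX) * (yh Z * Λ - MY))
  have e1 : ∑ Z ∈ P.powerset.filter (fun Z => Disjoint Z {w}),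
      μ Z * ρ Z * (xh Z * Λ - MX) * (yh Z * Λ - MY) = b := by
    refine Finset.sum_congr rfl fun Z hZ => ?_
    rw [Finset.mem_filter] at hZ
    rw [hρ1 Z hZ.1 (Finset.disjoint_singleton_right.mp hZ.2)]
    show μ Z * 1 * (xh Z * Λ - MX) * (yh Z * Λ - MY) = μ Z * (xh Z * Λ - MX) * (yh Z * Λ - MY)
    ring
  have e2 : ∑ Z ∈ P.powerset.filter (fun Z => ¬ Disjoint Z {w}),
      μ Z * ρ Z * (xh Z * Λ - MX) * (yh Z * Λ - MY) = ∑ Z ∈ I, ρ Z * T Z := by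
    have : P.powerset.filter (fun Z => ¬ Disjoint Z {w}) = I := by
      refine Finset.filter_congr fun Z _ => ?_
      rw [Finset.disjoint_singleton_right, not_not]
    rw [this]
    refine Finset.sum_congr rfl fun Z _ => ?_
    show μ Z * ρ Z * (xh Z * Λ - MX) * (yh Z * Λ - MY) = ρ Z * (μ Z * (xh Z * Λ - MX) * (yh Z * Λ - MY))
    ring
  rw [e1, e2] at hsplit
  rw [← hsplit]
  -- every up-set of `I` has a nonnegative block
  have hclass : ∀ Z ∈ P.powerset, w ∈ Z → T Z ≠ 0 →
      Z = {w, v₁, v₂} ∨ Z = {w, v₃, v₄} ∨ Z = {w, v₁, v₂, v₄} ∨ Z = {w, v₂, v₃, v₄} ∨ Z = P := by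
    intro Z hZ hwZ hT
    have hμZ : μ Z ≠ 0 := by
      intro h0; apply hT
      show μ Z * (xh Z * Λ - MX) * (yh Z * Λ - MY) = 0
      rw [h0]; simp
    exact twoChains_wtrace_classify hwv₁ hwv₂ hwv₃ hwv₄ hv₁₂ hv₁₃ hv₁₄ hv₂₃ hv₂₄ hv₃₄ μ hμ0a hμ0b
      hμ0c hZ hwZ hμZ
  have hw1 := hwv₁.symm; have hw2 := hwv₂.symm; have hw3 := hwv₃.symm; have hw4 := hwv₄.symm
  have h21 := hv₁₂.symm; have h31 := hv₁₃.symm; have h41 := hv₁₄.symm; have h32 := hv₂₃.symm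
  have h42 := hv₂₄.symm; have h43 := hv₃₄.symm
  have hU : ∀ U : Finset (Finset V), U ⊆ I → (∀ Z ∈ U, ∀ Z' ∈ I, Z ⊆ Z' → Z' ∈ U) →
      0 ≤ b + ∑ Z ∈ U, T Z := by
    intro U hUI hUup
    have sAP : ({w, v₁, v₂} : Finset V) ⊆ P := by
      intro z hz; simp only [Finset.mem_insert, Finset.mem_singleton] at hz
      rcases hz with rfl | rfl | rfl <;> simp [hPdef]
    have sBP : ({w, v₃, v₄} : Finset V) ⊆ P := by
      intro z hz; simp only [Finset.mem_insert, Finset.mem_singleton] at hz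
      rcases hz with rfl | rfl | rfl <;> simp [hPdef]
    have sCP : ({w, v₁, v₂, v₄} : Finset V) ⊆ P := by
      intro z hz; simp only [Finset.mem_insert, Finset.mem_singleton] at hz
      rcases hz with rfl | rfl | rfl | rfl <;> simp [hPdef]
    have sDP : ({w, v₂, v₃, v₄} : Finset V) ⊆ P := by
      intro z hz; simp only [Finset.mem_insert, Finset.mem_singleton] at hz
      rcases hz with rfl | rfl | rfl | rfl <;> simp [hPdef]
    have sAC : ({w, v₁, v₂} : Finset V) ⊆ {w, v₁, v₂, v₄} := by
      intro z hz; simp only [Finset.mem_insert, Finset.mem_singleton] at hz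
      rcases hz with rfl | rfl | rfl <;> simp
    have sBD : ({w, v₃, v₄} : Finset V) ⊆ {w, v₂, v₃, v₄} := by
      intro z hz; simp only [Finset.mem_insert, Finset.mem_singleton] at hz
      rcases hz with rfl | rfl | rfl <;> simp
    exact twoChains_upset_block_nonneg P T {w, v₁, v₂} {w, v₃, v₄} {w, v₁, v₂, v₄} {w, v₂, v₃, v₄}
      rfl rfl rfl rfl hwP sAP sBP sCP sDP sAC sBD (by simp) (by simp) (by simp [h31, h32, hw3])
      (by simp [h41, h42, hw4]) (by simp [hv₁₃, hv₁₄, hw1]) (by simp [hv₂₃, hv₂₄, hw2]) (by simp)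
      (by simp) (by simp) (by simp) (by simp [h31, h32, hv₃₄, hw3]) (by simp) (by simp [hv₁₂, hv₁₃, hv₁₄, hw1])
      (by simp) (by simp) (by simp) hv₁P hv₂P hv₃P hv₄P hclass hA' hTop hC₁ hC₂ hC₃ hC₄ hAll hHC hHD
      hHCD U hUI hUup
  -- the layer cake
  have hlayer := upset_layer_nonneg I T b hU 1 ρ zero_le_one
    (fun Z hZ => hρ0 Z (Finset.mem_filter.mp hZ).1) (fun Z hZ => hρle Z (Finset.mem_filter.mp hZ).1)
    (fun Z hZ Z' hZ' h => hρmono Z (Finset.mem_filter.mp hZ).1 Z' (Finset.mem_filter.mp hZ').1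
      (Finset.mem_filter.mp hZ).2 h)
  linarith [hlayer]

end TwoChainsAll

end Summit.Ventures.PercRepro2.Coin
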